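import Summits.QuantumFields.BalabanUV.Beta.RootedMixedJetContact
import Summits.QuantumFields.BalabanUV.Beta.RootedMixedJetSigns

/-!
# `BalabanUV.Beta.RootedMixedJetSingle` — THE AXIS-REFLECTION LAW OF THE ROOTED MIXED JET AT SINGLE LETTERS, IN COUNTS
# (β sub-cell, row D1 letter chain HR-W-LET, MIXED sub-chain M3c toward the level-0 mixed identity (M₀); an3 gen 33)

HONEST FRAMING (cell charter, verbatim): «discharging BetaPertH makes Bałaban's UV stability UNCONDITIONAL — a real
constructive-QFT result; it is NOT the continuum limit and NOT the Clay problem.»  HONEST DEPENDENCY (verbatim): «continuum YM on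
T⁴ ⇐ BetaPertH ∧ nine spine estimates (0/9 proved); BetaPertH ⇐ (D1) ∧ (D4) ∧ CAP+tail; G-an2-4 gates asym, D1 and NE2/3/4.»
DERIVED cell leaf: [folklore] letter algebra over node 12b `AveragingMixedJetTables` (`MjetAt ρ`), node 7aρ
`AveragingHessianKernelsRooted` (`linCountAt`, `hessCountAt`, `linAvgAt_single`, `hessUAt_single`), node 7a `AveragingHessianKernels`
(`single`, `bw_single`, `comm`), leaf-05-g7's `RootedMixedJetSigns` (MX3: `R1g_single`, `MjetAt_neg_W`, `MjetAt_neg_V`), an3-g33's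
`RootedMixedJetLinear` (33M1: `MjetAt_neg_B`), `RootedMixedJetReflectionLaw` (33M2: the axis-correction components `D1R`, `D2R`, `D12R`) and
`RootedMixedJetContact` (33M3b: `MjetAt_sref_of_ne_counts`, `MjetAt_bref_self_counts`), all BY NAME.  No statement of Bałaban's papers
is typed, no `[cite:]`, no `Prop` is minted, no binder of the β-function wall (`hW`/`hR`/`D1Tel`/`D1Rep`, (D1), `BetaPertH`) is
instantiated or discharged.  NOT summit progress.

## What this module proves (`ρ_c = ctr d L`, `L` odd, `(L : 𝕜) ≠ 0`, `(2 : 𝕜) ≠ 0` in §4; any root `ρ` in §2–§3)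

Throughout the letters are SINGLE-BOND forms seen through the signed pull-back of leaf-05-g7's MX3: the hypotheses
`R1g α W = single F a`, `R1g α V = single F′ b`, `R1g α B = single G c` (for `W = single f a₀` this is MX3's `R1g_single` with
`F = fref α f`, `a = ± a₀`).
* §1 THE AXIS-CORRECTION COMPONENTS AT SINGLE LETTERS: `D1R = single F ([F = G on the axis] · [c, a])`,
  `D2R = single F′ ([F′ = G on the axis] · [c, b])`, `D12R = single F ([F = F′ = G on the axis] · (½{a,b}c + c½{a,b} − acb − bca))`.
* §2 THE CONTACT FUNCTIONALS AT SINGLE LETTERS IN COUNTS (`contact_single`, `lin_single_ite`, `comm_hess_lin_single`):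
  `s • (hessUAt ρ (single F₁ u) (single F₂ x) + linAvgAt ρ [single F₁ u, single F₂ x])`
  `= s • ((hessCountAt ρ F₁ F₂ + [F₁ = F₂]·linCountAt ρ F₁) • [u, x])`, and
  `[s • hessUAt ρ (single F a) (single F′ b), t • linAvgAt ρ (single G c)]`
  `= (s t) • ((hessCountAt ρ F F′ · linCountAt ρ G) • [[a,b],c])`.
* §3 SIGNS: `single f (−w) = −single f w`, MX3's signed letter `(if P then −a else a) = (±1) • a`, and the signs pull out of
  `MjetAt` at single letters (`MjetAt_single_signs`) and of the cubic contact letter `sym3` (`sym3_zsmul`).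
* §4 **THE AXIS-REFLECTION LAW OF NODE 12b's ROOTED MIXED JET AT SINGLE LETTERS, EVERY CORRECTION A COUNT**
  (`MjetAt_bref_of_single`): for every axis `α`, coarse direction `μ` and block `y`,
  `M(W,V;B)(μ, bref α μ y) = ε_μ • ( M(single F a, single F′ b; single G c)(μ, y)`
  `  + [F = G, F on the axis] · (2L^d)⁻¹ • ((hessCountAt F′ F + [F′ = F] linCountAt F′) • [b,[c,a]])`
  `  + [F′ = G, F′ on the axis] · (2L^d)⁻¹ • ((hessCountAt F F′ + [F = F′] linCountAt F) • [a,[c,b]])`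
  `  + [F = F′ = G on the axis] · L^{-d} • (linCountAt F • (½{a,b}c + c½{a,b} − acb − bca))`
  `  + [μ = α] · (2L^d)⁻¹ L^{-d} • ((hessCountAt F F′ · linCountAt G) • [[a,b],c]) )`, `ε_μ = −1` if `μ = α` else `1`
  (all counts rooted at `ρ_c`, at `(μ, y)`).  This is 33M3b's pair of laws with 33M2's axis correction evaluated by §1–§2.

## What is NOT here
No table (`aTab`, `tTab`, `mixKerAt`; M4), no matrix letters `E i j`, no packed identity (`hM_an1`, leaf-05-g7's
`MixedLetterPacking`∕`MixedLetterUnpacking`), no kernel (`hessFFAt`, `linKerAt`, `ctGen`).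
-/

namespace Summit.QuantumFields.BalabanUV.Beta.RootedMixedJetSingle

open Literature.MathematicalPhysics.QuantumFieldTheory.Balaban1983to89
open Literature.MathematicalPhysics.QuantumFieldTheory.Balaban1983to89.Beta
open AffineAveraging (Form1)
open AveragingContoursRooted (ctr linAvgAt)
open AveragingHessianKernels (Bond single single_apply bw bw_single)
open AveragingHessianKernelsRooted (hessUAt linCountAt hessCountAt linAvgAt_single hessUAt_single)
open AveragingThirdJet (Tau)
open AveragingThirdJet.Tau (ι)
open AveragingMixedJetTables (MjetAt)
open ResolventReflection (sref bref bref_of_ne)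
open Summit.QuantumFields.BalabanUV.Beta.RootedHolonomyReflection (R1g)
open Summit.QuantumFields.BalabanUV.Beta.RootedMixedJetReflectionLaw (D1R D2R D12R)
open Summit.QuantumFields.BalabanUV.Beta.RootedMixedJetContact (MjetAt_sref_of_ne_counts MjetAt_bref_self_counts)
open RootedKernelReflection (fref fref_fst fref_injective)
open Summit.QuantumFields.BalabanUV.Beta.RootedMixedJetLinear (MjetAt_neg_B)
open Summit.QuantumFields.BalabanUV.Beta.RootedMixedJetSigns (R1g_single MjetAt_neg_W MjetAt_neg_V)

variable {𝕜 : Type*} [Field 𝕜] {d : ℕ} {𝔸 : Type*} [Ring 𝔸] [Algebra 𝕜 𝔸]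

/-! ## §1 The axis-correction components at single letters -/

variable (𝕜) in
/-- [folklore] THE CUBIC CONTACT LETTER `½{a,b}·c + c·½{a,b} − a c b − b c a` (33M2's `D12R` at one bond). -/
noncomputable def sym3 (a b c : 𝔸) : 𝔸 :=
  (2 : 𝕜)⁻¹ • (a * b + b * a) * c + c * ((2 : 𝕜)⁻¹ • (a * b + b * a)) - a * c * b - b * c * a

section Forms

variable {α : Fin d} {W V B : Form1 d 𝔸} {F F' G : Bond d} {a b c : 𝔸}

/-- [folklore] `D1R` at single letters: supported on `F`, with value `[c, a]` iff `F = G` lies on the axis. -/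
theorem D1R_of_single (hW : R1g α W = single F a) (hB : R1g α B = single G c) (V : Form1 d 𝔸) :
    D1R α W V B = single F (if F = G ∧ F.1 = α then AveragingHessianKernels.comm c a else 0) := by
  funext κ x
  simp only [D1R, hW, hB, single_apply, AveragingHessianKernels.comm]
  by_cases hF : (κ, x) = F
  · subst hF
    by_cases hG : (κ, x) = G
    · subst hG
      by_cases h1 : κ = α <;> simp [h1]
    · simp [hG]
  · simp [hF]

/-- [folklore] `D2R` at single letters: supported on `F′`, with value `[c, b]` iff `F′ = G` lies on the axis. -/
theorem D2R_of_single (hV : R1g α V = single F' b) (hB : R1g α B = single G c) (W : Form1 d 𝔸) :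
    D2R α W V B = single F' (if F' = G ∧ F'.1 = α then AveragingHessianKernels.comm c b else 0) := by
  funext κ x
  simp only [D2R, hV, hB, single_apply, AveragingHessianKernels.comm]
  by_cases hF : (κ, x) = F'
  · subst hF
    by_cases hG : (κ, x) = G
    · subst hG
      by_cases h1 : κ = α <;> simp [h1]
    · simp [hG]
  · simp [hF]

/-- [folklore] `D12R` at single letters: supported on `F`, with value `½{a,b}·c + c·½{a,b} − a c b − b c a` iff
`F = F′ = G` lies on the axis. -/
theorem D12R_of_single (hW : R1g α W = single F a) (hV : R1g α V = single F' b) (hB : R1g α B = single G c) :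
    D12R (𝕜 := 𝕜) α W V B = single F (if F = F' ∧ F' = G ∧ F.1 = α then sym3 𝕜 a b c else 0) := by
  funext κ x
  simp only [D12R, hW, hV, hB, single_apply, sym3]
  by_cases hF : (κ, x) = F
  · subst hF
    by_cases hF' : (κ, x) = F'
    · subst hF'
      by_cases hG : (κ, x) = G
      · subst hG
        by_cases h1 : κ = α <;> simp [h1]
      · simp [hG]
    · simp [hF']
  · simp [hF]

end Forms

/-! ## §2 The contact functionals at single letters, in counts -/

/-- [folklore] THE CONTACT FUNCTIONAL of 33M3b at single letters:
`s • (hessUAt ρ (single F₁ u) (single F₂ x) + linAvgAt ρ [single F₁ u, single F₂ x])`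
`= s • ((hessCountAt F₁ F₂ + [F₁ = F₂]·linCountAt F₁) • [u, x])` (node 7aρ's `hessUAt_single`, `linAvgAt_single`, node 7a's
`bw_single`), written for a letter `x` guarded by a condition `P`. -/
theorem contact_single (ρ : Fin d → ℤ) (F₁ F₂ : Bond d) (u x : 𝔸) (P : Prop) [Decidable P] (s : 𝕜) (L : ℕ) (μ : Fin d)
    (y : Fin d → ℤ) :
    s • (hessUAt ρ (single F₁ u) (single F₂ (if P then x else 0)) L μ y
          + linAvgAt ρ (bw (single F₁ u) (single F₂ (if P then x else 0))) L μ y)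
      = if P then s • ((hessCountAt ρ L μ y F₁ F₂ + (if F₁ = F₂ then linCountAt ρ L μ y F₁ else 0))
          • AveragingHessianKernels.comm u x) else 0 := by
  rw [hessUAt_single, bw_single, linAvgAt_single]
  by_cases hP : P
  · simp only [if_pos hP]
    by_cases h12 : F₁ = F₂
    · simp only [if_pos h12, add_smul]
    · simp only [if_neg h12, smul_zero, add_zero]
  · simp [hP]

/-- [folklore] `s • linAvgAt ρ (single F x) = s • (linCountAt F • x)`, written for a guarded letter. -/
theorem lin_single_ite (ρ : Fin d → ℤ) (F : Bond d) (x : 𝔸) (P : Prop) [Decidable P] (s : 𝕜) (L : ℕ) (μ : Fin d)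
    (y : Fin d → ℤ) :
    s • linAvgAt ρ (single F (if P then x else 0)) L μ y = if P then s • (linCountAt ρ L μ y F • x) else 0 := by
  rw [linAvgAt_single]
  split_ifs <;> simp

/-- [folklore] THE COMMUTATOR of 33M3b's longitudinal law at single letters:
`[s • hessUAt ρ (single F a) (single F′ b), t • linAvgAt ρ (single G c)]`
`= (s t) • ((hessCountAt F F′ · linCountAt G) • [[a, b], c])`. -/
theorem comm_hess_lin_single (ρ : Fin d → ℤ) (F F' G : Bond d) (a b c : 𝔸) (s t : 𝕜) (L : ℕ) (μ : Fin d) (y : Fin d → ℤ) :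
    AveragingHessianKernels.comm (s • hessUAt ρ (single F a) (single F' b) L μ y) (t • linAvgAt ρ (single G c) L μ y)
      = (s * t) • ((hessCountAt ρ L μ y F F' * linCountAt ρ L μ y G)
          • AveragingHessianKernels.comm (AveragingHessianKernels.comm a b) c) := by
  rw [hessUAt_single, linAvgAt_single]
  set X := AveragingHessianKernels.comm a b
  simp only [AveragingHessianKernels.comm, smul_mul_smul_comm, smul_sub, mul_comm t s,
    mul_comm (linCountAt ρ L μ y G) (hessCountAt ρ L μ y F F')]

/-! ## §3 Signs: the signed pull-back letters pull out of every term -/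

/-- [folklore] `single f (−w) = −single f w`. -/
theorem single_neg (f : Bond d) (w : 𝔸) : single f (-w) = -single f w := by
  funext κ x
  simp only [single_apply, Pi.neg_apply]
  split_ifs <;> simp

/-- [folklore] MX3's signed letter as an integer multiple: `(if P then −a else a) = (if P then −1 else 1) • a`. -/
theorem ite_neg_eq_zsmul (P : Prop) [Decidable P] (a : 𝔸) : (if P then -a else a) = (if P then -1 else 1 : ℤ) • a := by
  split_ifs <;> simp

/-- [folklore] SIGNS PULL OUT OF THE MIXED JET AT SINGLE LETTERS (MX3's `MjetAt_neg_W`, `MjetAt_neg_V`, 33M1's `MjetAt_neg_B`). -/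
theorem MjetAt_single_signs (ρ : Fin d → ℤ) (F F' G : Bond d) (a b c : 𝔸) (P Q R : Prop) [Decidable P] [Decidable Q]
    [Decidable R] (L : ℕ) (μ : Fin d) (y : Fin d → ℤ) :
    MjetAt 𝕜 ρ (single F ((if P then -1 else 1 : ℤ) • a)) (single F' ((if Q then -1 else 1 : ℤ) • b))
        (single G ((if R then -1 else 1 : ℤ) • c)) L μ y
      = ((if P then -1 else 1 : ℤ) * (if Q then -1 else 1 : ℤ) * (if R then -1 else 1 : ℤ))
          • MjetAt 𝕜 ρ (single F a) (single F' b) (single G c) L μ y := by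
  split_ifs <;> simp [single_neg, MjetAt_neg_W, MjetAt_neg_V, MjetAt_neg_B]

/-- [folklore] Integer scalars pull out of the cubic contact letter. -/
theorem sym3_zsmul (z₁ z₂ z₃ : ℤ) (a b c : 𝔸) :
    sym3 𝕜 (z₁ • a) (z₂ • b) (z₃ • c) = (z₁ * z₂ * z₃) • sym3 𝕜 a b c := by
  simp only [sym3, smul_mul_assoc, mul_smul_comm, smul_add, smul_sub, add_mul, mul_add]
  module

/-! ## §4 The axis-reflection law of `MjetAt` at single letters, every correction a count -/

section Law

variable {L : ℕ} (hL : Odd L) (h2 : (2 : 𝕜) ≠ 0) (hL0 : (L : 𝕜) ≠ 0)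
include hL h2 hL0

/-- [folklore] **THE AXIS-REFLECTION LAW OF NODE 12b's ROOTED MIXED JET AT SINGLE LETTERS, EVERY CORRECTION A COUNT.**
For letters whose signed pull-backs are single-bond forms (`R1g α W = single F a`, `R1g α V = single F′ b`,
`R1g α B = single G c`; e.g. MX3's `R1g_single`), at the reflected block `(μ, bref α μ y)`:
`M(W,V;B) = ε_μ • ( M(single F a, single F′ b; single G c)(μ,y)`
`+ [F = G ∧ F on axis]·(2L^d)⁻¹•((h(F′,F) + [F′=F] q(F′))•[b,[c,a]])`
`+ [F′ = G ∧ F′ on axis]·(2L^d)⁻¹•((h(F,F′) + [F=F′] q(F))•[a,[c,b]])`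
`+ [F = F′ = G on axis]·L^{-d}•(q(F)•(½{a,b}c + c½{a,b} − acb − bca))`
`+ [μ = α]·(2L^d)⁻¹L^{-d}•((h(F,F′)·q(G))•[[a,b],c]) )`, `ε_μ = −1` if `μ = α` else `1`, `h = hessCountAt ρ_c`,
`q = linCountAt ρ_c`
at `(μ, y)` — 33M3b's `MjetAt_sref_of_ne_counts` (`μ ≠ α`, `bref = sref`) and `MjetAt_bref_self_counts` (`μ = α`) with §1–§2. -/
theorem MjetAt_bref_of_single (α μ : Fin d) {W V B : Form1 d 𝔸} {F F' G : Bond d} {a b c : 𝔸}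
    (hW : R1g α W = single F a) (hV : R1g α V = single F' b) (hB : R1g α B = single G c) (y : Fin d → ℤ) :
    MjetAt 𝕜 (ctr d L) W V B L μ (bref α μ y)
      = (if μ = α then (-1 : ℤ) else 1) •
        (MjetAt 𝕜 (ctr d L) (single F a) (single F' b) (single G c) L μ y
          + (if F = G ∧ F.1 = α then ((2 : 𝕜) * (L : 𝕜) ^ d)⁻¹ •
              ((hessCountAt (ctr d L) L μ y F' F + (if F' = F then linCountAt (ctr d L) L μ y F' else 0))
                • AveragingHessianKernels.comm b (AveragingHessianKernels.comm c a)) else 0)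
          + (if F' = G ∧ F'.1 = α then ((2 : 𝕜) * (L : 𝕜) ^ d)⁻¹ •
              ((hessCountAt (ctr d L) L μ y F F' + (if F = F' then linCountAt (ctr d L) L μ y F else 0))
                • AveragingHessianKernels.comm a (AveragingHessianKernels.comm c b)) else 0)
          + (if F = F' ∧ F' = G ∧ F.1 = α then ((L : 𝕜) ^ d)⁻¹ • (linCountAt (ctr d L) L μ y F • sym3 𝕜 a b c) else 0)
          + (if μ = α then (((2 : 𝕜) * (L : 𝕜) ^ d)⁻¹ * ((L : 𝕜) ^ d)⁻¹) •
              ((hessCountAt (ctr d L) L μ y F F' * linCountAt (ctr d L) L μ y G)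
                • AveragingHessianKernels.comm (AveragingHessianKernels.comm a b) c) else 0)) := by
  by_cases hμ : μ = α
  · subst hμ
    rw [MjetAt_bref_self_counts hL h2 hL0, D1R_of_single hW hB, D2R_of_single hV hB, D12R_of_single hW hV hB, hW, hV, hB,
      contact_single, contact_single, lin_single_ite, comm_hess_lin_single, if_pos (rfl : μ = μ), if_pos (rfl : μ = μ),
      neg_one_zsmul]
  · rw [bref_of_ne hμ, MjetAt_sref_of_ne_counts hL h2 hL0 hμ, D1R_of_single hW hB, D2R_of_single hV hB,
      D12R_of_single hW hV hB, hW, hV, hB, contact_single, contact_single, lin_single_ite, if_neg hμ, if_neg hμ, one_zsmul,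
      add_zero]

/-- [folklore] **THE SAME LAW FOR SINGLE LETTERS `W = single f a`, `V = single f′ b`, `B = single g c`, ALL SIGNS PULLED OUT**
(MX3's `R1g_single`: `F = fref α f`, the letter `±a`; §3): the global sign is `ε_μ · ε_f · ε_{f′} · ε_g`
(`ε_h = −1` iff the bond `h` lies on the axis `α`), the bracket is the bracket of `MjetAt_bref_of_single` at the UNSIGNED letters
`a, b, c` on the reflected bonds `fref α f`, `fref α f′`, `fref α g` (conditions transported by `fref_injective`). -/
theorem MjetAt_single_bref (α μ : Fin d) (f f' g : Bond d) (a b c : 𝔸) (y : Fin d → ℤ) :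
    MjetAt 𝕜 (ctr d L) (single f a) (single f' b) (single g c) L μ (bref α μ y)
      = ((if μ = α then -1 else 1 : ℤ)
          * ((if f.1 = α then -1 else 1 : ℤ) * (if f'.1 = α then -1 else 1 : ℤ) * (if g.1 = α then -1 else 1 : ℤ))) •
        (MjetAt 𝕜 (ctr d L) (single (fref α f) a) (single (fref α f') b) (single (fref α g) c) L μ y
          + (if f = g ∧ f.1 = α then ((2 : 𝕜) * (L : 𝕜) ^ d)⁻¹ •
              ((hessCountAt (ctr d L) L μ y (fref α f') (fref α f)
                  + (if f' = f then linCountAt (ctr d L) L μ y (fref α f') else 0))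
                • AveragingHessianKernels.comm b (AveragingHessianKernels.comm c a)) else 0)
          + (if f' = g ∧ f'.1 = α then ((2 : 𝕜) * (L : 𝕜) ^ d)⁻¹ •
              ((hessCountAt (ctr d L) L μ y (fref α f) (fref α f')
                  + (if f = f' then linCountAt (ctr d L) L μ y (fref α f) else 0))
                • AveragingHessianKernels.comm a (AveragingHessianKernels.comm c b)) else 0)
          + (if f = f' ∧ f' = g ∧ f.1 = α then
              ((L : 𝕜) ^ d)⁻¹ • (linCountAt (ctr d L) L μ y (fref α f) • sym3 𝕜 a b c) else 0)
          + (if μ = α then (((2 : 𝕜) * (L : 𝕜) ^ d)⁻¹ * ((L : 𝕜) ^ d)⁻¹) •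
              ((hessCountAt (ctr d L) L μ y (fref α f) (fref α f') * linCountAt (ctr d L) L μ y (fref α g))
                • AveragingHessianKernels.comm (AveragingHessianKernels.comm a b) c) else 0)) := by
  have eW : R1g α (single f a) = single (fref α f) ((if f.1 = α then -1 else 1 : ℤ) • a) := by rw [R1g_single, ite_neg_eq_zsmul]
  have eV : R1g α (single f' b) = single (fref α f') ((if f'.1 = α then -1 else 1 : ℤ) • b) := by
    rw [R1g_single, ite_neg_eq_zsmul]
  have eB : R1g α (single g c) = single (fref α g) ((if g.1 = α then -1 else 1 : ℤ) • c) := by rw [R1g_single, ite_neg_eq_zsmul]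
  rw [MjetAt_bref_of_single hL h2 hL0 α μ eW eV eB,
    mul_smul (if μ = α then (-1 : ℤ) else 1) ((if f.1 = α then (-1 : ℤ) else 1) * (if f'.1 = α then (-1 : ℤ) else 1)
      * (if g.1 = α then (-1 : ℤ) else 1))]
  congr 1
  simp only [MjetAt_single_signs, AveragingHessianKernels.comm_zsmul_zsmul, sym3_zsmul, fref_fst, (fref_injective α).eq_iff,
    smul_add, smul_ite, smul_zero]
  generalize (if f.1 = α then -1 else 1 : ℤ) = z₁
  generalize (if f'.1 = α then -1 else 1 : ℤ) = z₂
  generalize (if g.1 = α then -1 else 1 : ℤ) = z₃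
  congr 1
  · congr 1
    · congr 1
      · congr 1
        split_ifs <;> first | rfl | module
      · split_ifs <;> first | rfl | module
    · split_ifs <;> first | rfl | module
  · split_ifs <;> first | rfl | module

end Law

end Summit.QuantumFields.BalabanUV.Beta.RootedMixedJetSingle
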